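import Literature.RingTheory.HilbertSamuel.LocalRing
import Mathlib.RingTheory.Localization.Ideal
import Mathlib.Algebra.Module.LocalizedModule.Basic
import Mathlib.Algebra.Module.Equiv.Basic
import HarnessLib

/-!
# The graded pieces `Iⁿ/Iⁿ⁺¹` commute with localization: `(IA')ⁿ/(IA')ⁿ⁺¹ = S⁻¹(Iⁿ/Iⁿ⁺¹)`

Topic: `Literature/RingTheory/HilbertSamuel`. Infrastructure for normal flatness (CJS 2020,
Def. 3.1: flatness of the graded pieces `gr_{I_D}(𝒪_X)_x = ⊕ I_{D,x}^t/I_{D,x}^{t+1}`; Thm. 3.2 (1)/(3):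
its behaviour along `D` and under flat base change): for a localization `A → A' = S⁻¹A` and an
ideal `I ⊆ A` with extension `I' = IA'`, the natural `A`-linear map

  `θ : Iⁿ/Iⁿ⁺¹ → I'ⁿ/I'ⁿ⁺¹`,  `[x] ↦ [x/1]`

exhibits `I'ⁿ/I'ⁿ⁺¹` as the localization `S⁻¹(Iⁿ/Iⁿ⁺¹)` (`IsLocalizedModule S θ`): the elements of
`S` act invertibly; every class `[z]`, `z = w/t ∈ I'ⁿ = S⁻¹Iⁿ`, is `t⁻¹θ[w]`; and `θ[w] = 0`, i.e.
`w/1 ∈ I'ⁿ⁺¹ = S⁻¹Iⁿ⁺¹`, forces `cw ∈ Iⁿ⁺¹` for some `c ∈ S`. In particular the stalks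
`gr_{I_D}(𝒪_X)_x` of CJS Def. 3.1 are the localizations of the graded pieces of the ideal of
sections, the form in which generic statements on an affine open (`GenericNormalFlatness.lean`)
pass to the local rings.

* `algebraMap_mem_map_pow` — `x ∈ Iⁿ ⇒ x/1 ∈ I'ⁿ`;
* `exists_isLocalizedModule_gradedPiece` — the map `θ` (given by its values on classes) and
  `IsLocalizedModule S θ`.

No definitions and no named facts are introduced (the map `θ` is produced existentially, with
its defining formula).

## Sources

* V. Cossart, U. Jannsen, S. Saito, *Desingularization: Invariants and Strategy*, LNM 2270
  (2020), Def. 3.1, Thm. 3.2 (p. 37–38). [CossartJannsenSaito2020]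
* Folklore (localization is exact and commutes with quotients and ideal powers).
-/

noncomputable section

namespace Literature.RingTheory.HilbertSamuel

universe u v

variable {A : Type u} [CommRing A] (S : Submonoid A) (A' : Type v) [CommRing A'] [Algebra A A']
variable (I : Ideal A) (n : ℕ)

/-- `x ∈ Iⁿ ⇒ x/1 ∈ (IA')ⁿ`. [folklore] -/
theorem algebraMap_mem_map_pow (x : ↥(I ^ n)) :
    algebraMap A A' x ∈ I.map (algebraMap A A') ^ n := by
  rw [← Ideal.map_pow]
  exact Ideal.mem_map_of_mem _ x.2

variable [IsLocalization S A']

/-- **`(IA')ⁿ/(IA')ⁿ⁺¹` is the localization `S⁻¹(Iⁿ/Iⁿ⁺¹)`** for `A' = S⁻¹A`: there is an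
`A`-linear map `θ : Iⁿ/Iⁿ⁺¹ → (IA')ⁿ/(IA')ⁿ⁺¹` with `θ[x] = [x/1]` which is a localization map at
`S` (`IsLocalizedModule S θ`). [folklore] -/
theorem exists_isLocalizedModule_gradedPiece :
    ∃ θ : gradedPiece I n →ₗ[A] gradedPiece (I.map (algebraMap A A')) n,
      IsLocalizedModule S θ ∧
      ∀ x : ↥(I ^ n), θ (gradedPiece.mk I n x) =
        gradedPiece.mk (I.map (algebraMap A A')) n ⟨algebraMap A A' x, algebraMap_mem_map_pow A' I n x⟩ := by
  set I' : Ideal A' := I.map (algebraMap A A') with hI'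
  -- `φ : Iⁿ → I'ⁿ`, `x ↦ x/1`
  let φ : ↥(I ^ n) →ₗ[A] ↥(I' ^ n) :=
    { toFun := fun x => ⟨algebraMap A A' x, algebraMap_mem_map_pow A' I n x⟩
      map_add' := fun x y => by apply Subtype.ext; simp
      map_smul' := fun a x => by
        apply Subtype.ext
        change algebraMap A A' (a • (x : A)) = a • algebraMap A A' (x : A)
        rw [smul_eq_mul, map_mul, Algebra.smul_def] }
  let ψ : ↥(I ^ n) →ₗ[A] gradedPiece I' n := (gradedPiece.mk I' n).restrictScalars A ∘ₗ φ
  have hψ : (I • ⊤ : Submodule A ↥(I ^ n)) ≤ LinearMap.ker ψ := by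
    rw [Submodule.smul_le]
    intro a ha x _
    rw [LinearMap.mem_ker, LinearMap.comp_apply, LinearMap.restrictScalars_apply,
      gradedPiece.mk_eq_zero_iff]
    change ((φ (a • x) : ↥(I' ^ n)) : A') ∈ I' ^ (n + 1)
    rw [LinearMap.map_smul]
    change a • algebraMap A A' (x : A) ∈ I' ^ (n + 1)
    rw [Algebra.smul_def, pow_succ']
    exact Ideal.mul_mem_mul (Ideal.mem_map_of_mem _ ha) (algebraMap_mem_map_pow A' I n x)
  let θ : gradedPiece I n →ₗ[A] gradedPiece I' n := (I • ⊤ : Submodule A ↥(I ^ n)).liftQ ψ hψ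
  have hθ : ∀ x : ↥(I ^ n), θ (gradedPiece.mk I n x) =
      gradedPiece.mk I' n ⟨algebraMap A A' x, algebraMap_mem_map_pow A' I n x⟩ := fun x => rfl
  refine ⟨θ, ⟨?_, ?_, ?_⟩, hθ⟩
  · -- the elements of `S` act invertibly on the `A'`-module `I'ⁿ/I'ⁿ⁺¹`
    intro s
    have hu : IsUnit (algebraMap A A' s) := IsLocalization.map_units A' s
    obtain ⟨v, hv⟩ := hu.exists_left_inv
    rw [Module.End.isUnit_iff]
    constructor
    · intro y y' h
      simp only [Module.algebraMap_end_apply] at h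
      rw [← algebraMap_smul A' (s : A) y, ← algebraMap_smul A' (s : A) y'] at h
      have h' := congrArg (fun z => v • z) h
      simp only [smul_smul, hv, one_smul] at h'
      exact h'
    · intro y
      refine ⟨v • y, ?_⟩
      simp only [Module.algebraMap_end_apply]
      rw [← algebraMap_smul A' (s : A), smul_smul, mul_comm, hv, one_smul]
  · -- surjectivity up to denominators
    intro y
    obtain ⟨z, rfl⟩ := gradedPiece.mk_surjective I' n y
    have hz : (z : A') ∈ (I ^ n).map (algebraMap A A') := by rw [Ideal.map_pow]; exact z.2
    obtain ⟨⟨⟨w, hw⟩, t⟩, hzt⟩ := (IsLocalization.mem_map_algebraMap_iff S A').mp hz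
    refine ⟨(gradedPiece.mk I n ⟨w, hw⟩, t), ?_⟩
    change (t : A) • gradedPiece.mk I' n z = θ (gradedPiece.mk I n ⟨w, hw⟩)
    rw [hθ, ← LinearMap.map_smul_of_tower]
    congr 1
    apply Subtype.ext
    change (t : A) • (z : A') = algebraMap A A' w
    rw [Algebra.smul_def, mul_comm]
    exact hzt
  · -- kernel: `θ[w₁] = θ[w₂] ⇒ c w₁ ≡ c w₂ mod Iⁿ⁺¹` for some `c ∈ S`
    intro x₁ x₂ h
    obtain ⟨w₁, rfl⟩ := gradedPiece.mk_surjective I n x₁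
    obtain ⟨w₂, rfl⟩ := gradedPiece.mk_surjective I n x₂
    rw [hθ, hθ, ← sub_eq_zero, ← map_sub, gradedPiece.mk_eq_zero_iff] at h
    change algebraMap A A' w₁ - algebraMap A A' w₂ ∈ I' ^ (n + 1) at h
    rw [← map_sub, hI', ← Ideal.map_pow] at h
    obtain ⟨c, hc, hcw⟩ := (IsLocalization.algebraMap_mem_map_algebraMap_iff S A' _ _).mp h
    refine ⟨⟨c, hc⟩, ?_⟩
    change c • gradedPiece.mk I n w₁ = c • gradedPiece.mk I n w₂
    rw [← map_smul, ← map_smul, ← sub_eq_zero, ← map_sub, gradedPiece.mk_eq_zero_iff]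
    change c • (w₁ : A) - c • (w₂ : A) ∈ I ^ (n + 1)
    rwa [smul_eq_mul, smul_eq_mul, ← mul_sub]

end Literature.RingTheory.HilbertSamuel
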